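import Literature.AlgebraicTopology.SingularHomology.OrientationProofs
import Literature.AlgebraicTopology.SingularHomology.LocalHomologyMapsCoeff
import Literature.AlgebraicTopology.SingularHomology.FundamentalClassExistence
import HarnessLib

/-!
# `μ ↦ μ ⊗ 1` is natural under maps of pairs; degree one with coefficients

A. Hatcher, *Algebraic Topology* (2002), §2.2 p. 153 (a coefficient homomorphism induces natural maps
of all homology groups), §3.3 p. 235 (the `R`-orientation `x ↦ μₓ ⊗ 1` of a `ℤ`-oriented manifold),
Thm. 3.26. The tree's `intToCoeffClass R K n : Hₙ(X | K; ℤ) → Hₙ(X | K; R)` (`a ↦ a ⊗ 1`, file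
`OrientationProofs`) is the concrete change of coefficients `clocalHomology.coeffMap` transported along
the chosen comparison isomorphisms `localHomologyOfSet.comparisonIso` of the two models of local
homology. This file proves:

* `relativeSingularChainComplex.map_comp_awayComparisonIso_hom`,
  `localHomologyOfSet.comparisonIso_hom_map` — **the comparison isomorphisms are natural under maps of
  pairs** (both models' `f_*` are induced by `f♯` on chains; the chosen comparison intertwines the
  projections, `π_comp_awayComparisonIso_hom`);
* `map_intToCoeffClass` — **`f_* (a ⊗ 1) = (f_* a) ⊗ 1`** for a map of pairs
  `f : (X, X ∖ K) → (Y, Y ∖ L)` (`clocalHomology.map_coeffMap_apply` and the naturality above);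
* `HomologicalOrientation.map_toCoeff_localClass` — if `f_* μ'ₐ = μ_b` for `ℤ`-orientations, then
  `f_* (μ' ⊗ 1)ₐ = (μ ⊗ 1)_b` for the induced `R`-orientations `HomologicalOrientation.toCoeff`;
* `hasDegree_one_toCoeff_of_map_localClass_eq` — **degree one with `R`-coefficients from one good
  integral fibre**: for a map of closed manifolds, `Y` connected, which is a map of pairs
  `(X, X ∖ a) → (Y, Y ∖ b)` with `f_* μ'ₐ = μ_b` integrally, `f_* [X]_{μ' ⊗ R} = [Y]_{μ ⊗ R}` (Hatcher
  Thm. 3.26: naturality of `Hₙ(–) → Hₙ(– | b)` and its injectivity for `Y` closed connected).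

Everything is proved; no definitions, no named facts.

## References

* [HatcherAT2002] A. Hatcher, Algebraic Topology, CUP 2002, §2.1, §2.2 p. 153, §3.3 p. 235, Thm. 3.26.
-/

noncomputable section

open CategoryTheory Limits Set

universe u v

namespace Literature.AlgebraicTopology.SingularHomology

/-! ### Naturality of the chosen comparison of the two models of local homology -/

section Comparison

variable (R : Type v) [CommRing R] (M : Type v) [AddCommGroup M] [Module R M]
variable {X Y : Type u} [TopologicalSpace X] [TopologicalSpace Y]

/-- **The chosen comparison isomorphisms are natural under maps of pairs, on chains**:
`f_* ≫ cmp_L = cmp_K ≫ f_*` for `f : (X, X ∖ K) → (Y, Y ∖ L)`, where on the left `f_*` is Mathlib's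
map of relative chain complexes and on the right the map of concrete quotient complexes
(`clocalHomology.quotChainMap`) — both are induced by `f♯ : C_•(X) → C_•(Y)`, the comparison
intertwines the projections (`π_comp_awayComparisonIso_hom`) and `f♯` commutes with the comparison
`C_•(–) ≅ C(–)` (`csingularChainComplex.map_comp_compIso_hom`). [cite: HatcherAT2002, §2.1] -/
theorem relativeSingularChainComplex.map_comp_awayComparisonIso_hom {K : Set X} {L : Set Y}
    (f : C(X, Y)) (h : MapsTo f Kᶜ Lᶜ) :
    relativeSingularChainComplex.map R M f h ≫ (awayComparisonIso R M L).hom =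
      (awayComparisonIso R M K).hom ≫ clocalHomology.quotChainMap R M f h := by
  haveI := relativeSingularChainComplex.epi_π R M (X := X) Kᶜ
  have hnat : singularChainComplex.map R M f ≫ (csingularChainComplex.compIso R M Y).inv =
      (csingularChainComplex.compIso R M X).inv ≫ csingularChainComplex.map R M f := by
    rw [Iso.comp_inv_eq, Category.assoc, csingularChainComplex.map_comp_compIso_hom,
      Iso.inv_hom_id_assoc]
  rw [← cancel_epi (relativeSingularChainComplex.π R M X Kᶜ),
    relativeSingularChainComplex.π_comp_map_assoc, π_comp_awayComparisonIso_hom R M L,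
    ← Category.assoc, hnat, Category.assoc, ← Category.assoc (relativeSingularChainComplex.π R M X Kᶜ),
    π_comp_awayComparisonIso_hom R M K, Category.assoc, clocalHomology.quotChainMap,
    Subcomplex.π_quotMap]

/-- **The comparison isomorphisms of local homology are natural under maps of pairs**:
`cmp_L (f_* x) = f_* (cmp_K x)` on `Hᵢ(X | K; M)` (homology of
`relativeSingularChainComplex.map_comp_awayComparisonIso_hom`). [cite: HatcherAT2002, §2.1] -/
theorem localHomologyOfSet.comparisonIso_hom_map {K : Set X} {L : Set Y} (f : C(X, Y))
    (h : MapsTo f Kᶜ Lᶜ) (i : ℕ) (x : localHomologyOfSet R M X K i) :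
    (localHomologyOfSet.comparisonIso R M L i).hom (relativeSingularHomology.map R M f h i x) =
      clocalHomology.map R M f h i ((localHomologyOfSet.comparisonIso R M K i).hom x) := by
  change (HomologicalComplex.homologyMap (relativeSingularChainComplex.map R M f h) i ≫
      HomologicalComplex.homologyMap (awayComparisonIso R M L).hom i) x =
    (HomologicalComplex.homologyMap (awayComparisonIso R M K).hom i ≫
      HomologicalComplex.homologyMap (clocalHomology.quotChainMap R M f h) i) x
  rw [← HomologicalComplex.homologyMap_comp, ← HomologicalComplex.homologyMap_comp,
    relativeSingularChainComplex.map_comp_awayComparisonIso_hom]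

/-- Inverse form: `cmp_L⁻¹ (f_* y) = f_* (cmp_K⁻¹ y)`. [cite: HatcherAT2002, §2.1] -/
theorem localHomologyOfSet.comparisonIso_inv_map {K : Set X} {L : Set Y} (f : C(X, Y))
    (h : MapsTo f Kᶜ Lᶜ) (i : ℕ) (y : clocalHomology R M X K i) :
    (localHomologyOfSet.comparisonIso R M L i).inv (clocalHomology.map R M f h i y) =
      relativeSingularHomology.map R M f h i ((localHomologyOfSet.comparisonIso R M K i).inv y) := by
  have h1 := localHomologyOfSet.comparisonIso_hom_map R M f h i
    ((localHomologyOfSet.comparisonIso R M K i).inv y)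
  rw [Iso.inv_hom_id_apply] at h1
  rw [← h1, Iso.hom_inv_id_apply]

end Comparison

/-! ### `a ↦ a ⊗ 1` is natural under maps of pairs -/

section IntToCoeff

variable (R : Type v) [CommRing R]
variable {X Y : Type u} [TopologicalSpace X] [TopologicalSpace Y]

/-- **`f_* (a ⊗ 1) = (f_* a) ⊗ 1`** for a map of pairs `f : (X, X ∖ K) → (Y, Y ∖ L)` and
`a ∈ Hₙ(X | K; ℤ)` (the coefficient homomorphism `ℤ → R` is natural, Hatcher §2.2 p. 153; here
`clocalHomology.map_coeffMap_apply` transported along the natural comparison isomorphisms).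
[cite: HatcherAT2002, §2.2 p. 153] -/
theorem map_intToCoeffClass {K : Set X} {L : Set Y} (f : C(X, Y)) (h : MapsTo f Kᶜ Lᶜ) (n : ℕ)
    (a : localHomologyOfSet ℤ ℤ X K n) :
    relativeSingularHomology.map R R f h n (intToCoeffClass R K n a) =
      intToCoeffClass R L n (relativeSingularHomology.map ℤ ℤ f h n a) := by
  rw [intToCoeffClass, intToCoeffClass, localHomologyOfSet.comparisonIso_hom_map,
    ← clocalHomology.map_coeffMap_apply, localHomologyOfSet.comparisonIso_inv_map]

/-- **`f_* (μ' ⊗ 1)ₐ = (μ ⊗ 1)_b` from `f_* μ'ₐ = μ_b`**: the `R`-orientations `x ↦ μₓ ⊗ 1` induced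
by `ℤ`-orientations (`HomologicalOrientation.toCoeff`, Hatcher p. 235) are carried to each other by a
map of pairs that carries the integral local classes to each other. [cite: HatcherAT2002, §3.3 p. 235] -/
theorem HomologicalOrientation.map_toCoeff_localClass {n : ℕ} [T2Space X] [T2Space Y]
    [ChartedSpace (EuclideanSpace ℝ (Fin n)) X] [ChartedSpace (EuclideanSpace ℝ (Fin n)) Y]
    (f : C(X, Y)) {a : X} {b : Y} (hfib : MapsTo f ({a}ᶜ : Set X) ({b}ᶜ : Set Y))
    (μ' : HomologicalOrientation ℤ X n) (μ : HomologicalOrientation ℤ Y n)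
    (h : relativeSingularHomology.map ℤ ℤ f hfib n (μ'.localClass a) = μ.localClass b) :
    relativeSingularHomology.map R R f hfib n ((μ'.toCoeff R).localClass a) =
      (μ.toCoeff R).localClass b := by
  rw [HomologicalOrientation.toCoeff_localClass, HomologicalOrientation.toCoeff_localClass,
    ← h]
  exact map_intToCoeffClass R f hfib n (μ'.localClass a)

end IntToCoeff

/-! ### Degree one with coefficients from one good integral fibre -/

section Degree

variable {R : Type v} [CommRing R] {n : ℕ}
variable {X Y : Type u} [TopologicalSpace X] [TopologicalSpace Y]
  [CompactSpace X] [T2Space X] [ChartedSpace (EuclideanSpace ℝ (Fin n)) X]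
  [CompactSpace Y] [T2Space Y] [ChartedSpace (EuclideanSpace ℝ (Fin n)) Y] [ConnectedSpace Y]

/-- **Degree one with `R`-coefficients from one good integral fibre.** Let `f : X → Y` be a map of
closed manifolds, `Y` connected, `a ∈ X`, `b ∈ Y` with `f (X ∖ a) ⊆ Y ∖ b` and `f_* μ'ₐ = μ_b` in
`Hₙ(Y | b; ℤ)` for `ℤ`-orientations `μ'`, `μ`. Then `f_* [X]_{μ' ⊗ R} = [Y]_{μ ⊗ R}` for the induced
`R`-orientations (`HasDegree (μ'.toCoeff R) (μ.toCoeff R) f 1`): `f_* (μ' ⊗ 1)ₐ = (μ ⊗ 1)_b`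
(`HomologicalOrientation.map_toCoeff_localClass`), both classes restrict to it at `b` (Thm. 3.26 (a),
`isFundamentalClass_fundamentalClass_holds`), and `Hₙ(Y; R) → Hₙ(Y | b; R)` is injective for `Y` closed
connected (Thm. 3.26 (b), `toLocal_injective_of_connectedSpace_holds`).
[cite: HatcherAT2002, §3.3 Thm. 3.26] -/
theorem hasDegree_one_toCoeff_of_map_localClass_eq (f : C(X, Y)) {a : X} {b : Y}
    (hfib : MapsTo f ({a}ᶜ : Set X) ({b}ᶜ : Set Y)) (μ' : HomologicalOrientation ℤ X n)
    (μ : HomologicalOrientation ℤ Y n)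
    (h : relativeSingularHomology.map ℤ ℤ f hfib n (μ'.localClass a) = μ.localClass b) :
    HasDegree (μ'.toCoeff R) (μ.toCoeff R) f 1 := by
  have hR := HomologicalOrientation.map_toCoeff_localClass R f hfib μ' μ h
  rw [HasDegree, one_zsmul]
  apply singularHomology.toLocal_injective_of_connectedSpace_holds R R Y n b
  have hnat := relativeSingularHomology.ofAbsolute_comp_map R R f hfib n
  have h1 : singularHomology.toLocal R R b n (singularHomology.map R R f n (μ'.toCoeff R).fundamentalClass) =
      relativeSingularHomology.map R R f hfib n
        (singularHomology.toLocal R R a n (μ'.toCoeff R).fundamentalClass) := by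
    change (singularHomology.map R R f n ≫ relativeSingularHomology.ofAbsolute R R Y {b}ᶜ n)
        (μ'.toCoeff R).fundamentalClass =
      (relativeSingularHomology.ofAbsolute R R X {a}ᶜ n ≫ relativeSingularHomology.map R R f hfib n)
        (μ'.toCoeff R).fundamentalClass
    rw [hnat]
  rw [h1, HomologicalOrientation.isFundamentalClass_fundamentalClass_holds n (μ'.toCoeff R) a,
    HomologicalOrientation.isFundamentalClass_fundamentalClass_holds n (μ.toCoeff R) b]
  exact hR

end Degree

end Literature.AlgebraicTopology.SingularHomology

end
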